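import Literature.Analysis.FluidPDE.ChaeWolfLocalLeray
import Literature.Analysis.FluidPDE.ForwardDSSExtension
import HarnessLib

/-!
# Chae–Wolf's Definition 1.2 (print-shaped clauses) and the tree's rendering of Theorem 1.4

Analysis/FluidPDE sibling file of `ChaeWolfLocalLeray.lean` (Chae–Wolf, *Existence of discretely
self-similar solutions to the Navier–Stokes equations for initial value in `L²_loc(ℝ³)`*, Ann.
Inst. H. Poincaré C Anal. Non Linéaire 35 (2018) 1019–1039 = arXiv:1610.01386, **Definition 1.2**,
**Theorem 1.4**, Appendix B, Lemma B.5 (B.9)). No named facts.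

Chae–Wolf's Theorem 1.4 is vendored in the tree ONCE, as the named fact
`chaeWolf2018_dss_existence` (`SelfSimilarLiouville.lean`), in the tree's weak-solution vocabulary:
an everywhere-`λ`-DSS field which is a pressure-free weak solution *with datum* on `[0, T)` for every
`T > 0`, with the local energy class, a weak gradient in `L²((0,T) × K)` and the `L²_loc` attainment
of the datum. This file records what Theorem 1.4 asserts **in the form in which it is printed** —
Definition 1.2, items (1)–(3), for a given field `u` and datum `u₀`, together with the discrete
self-similarity of *every* time slice (Chae–Wolf's `M(u) = [0, ∞)`, Lemma B.5 (B.9)) — as the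
predicate `ChaeWolf2018.IsDSSLocalLeraySolution c u₀ u`, and proves that the two readings of the
theorem are **equivalent**:

* `ChaeWolf2018.IsDSSLocalLeraySolution.dssRepr_spec`: if `u` satisfies the printed clauses, its
  everywhere-`λ`-DSS representative `dssRepr λ u` (`ChaeWolfLocalLeray.lean`) satisfies the five
  rendered clauses of `chaeWolf2018_dss_existence` — the two soft steps described in words in the
  module docstring of `SelfSimilarLiouville` ("Forward DSS existence"): (a) from slice-wise a.e.
  self-similarity to an everywhere-DSS representative (`dssRepr_slice_ae_eq`, `dssRepr_ae_eq_slab`: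
  the representative differs from `u` on a null set of the open slab and slice-wise on null sets at
  every `t > 0`, so every clause transfers), and (b) the time cut-off argument turning the
  distributional identity (2) on `ℝ³ × (0,∞)` plus the `L²_loc` attainment of the datum (3) into
  Leray's weak identity with datum on `[0, T)` (`weakIdentity_datum_of_divFree_distributional`);
  hence `chaeWolf2018_dss_existence_of_isDSSLocalLeraySolution`;
* `ChaeWolf2018.isDSSLocalLeraySolution_of_isWeakNSSolutionOn`: conversely a field with the five
  rendered clauses satisfies the printed ones — joint measurability on `(0,∞) × ℝ³` and weak
  divergence-freeness of a.e. slice by countable exhaustion of `(0,∞)`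
  (`ChaeWolf2018.aestronglyMeasurable_slab_Ioi_of_forall`, `ChaeWolf2018.ae_restrict_Ioi_of_forall`),
  (B.9) even pointwise because `u` is `λᵏ`-DSS identically for every `k ∈ ℤ`
  (`ChaeWolf2018.nsRescale_zpow_eq`), and Definition 1.2 (2) on `ℝ³ × (0,∞)` from the weak
  identities with datum, taking `T` beyond the support of the test field
  (`ChaeWolf2018.setIntegral_slab_Ioi_momentum_eq_zero_of_forall_isWeakNSSolutionOn`, general
  viscosity `ν` and force `f`; Fubini only); hence
  `ChaeWolf2018.exists_isDSSLocalLeraySolution_of_dss_existence` and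
  `chaeWolf2018_dss_existence_iff_isDSSLocalLeraySolution`.

Consequently the discharge of Theorem 1.4 in either reading is one and the same problem, pursued in
the tree along Bradshaw–Tsai 2019 (Analysis & PDE 12, Thm 1.2, "a slight refinement of the main
result of [Chae–Wolf]"; `chaeWolf2018_dss_existence_of_bradshawTsai2019`, and the reductions
`chaeWolf2018_dss_existence_of_prop_3_1` etc. of the `ForwardDSS*.lean` files), see
`ChaeWolf2018.exists_isDSSLocalLeraySolution_of_bradshawTsai2019`.

**History (D-0026 review, 2026-08-15).** The printed clauses were first vendored as a closed named
fact `chaeWolf2018_dss_localLeray_existence` (`∀` data `∃ u`, clauses), proved equivalent to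
`chaeWolf2018_dss_existence` (p21493). Being the same theorem at the same locator, it was not a
separate piece of literature debt; it has been merged back: the clauses live on as this predicate
(a definition with binders), the two implications as the theorems of this file.

## Omissions (as in `chaeWolf2018_dss_existence`)

Definition 1.2 (1)'s weak continuity `u ∈ C_w([0,T]; L²(G))` and item (4), the local energy
inequality with projected pressure (`v_G = u + ∇p_{h,G}`, `∇p_{h,G} = −E*_G(u)`), are not rendered:
the tree has no Stokes pressure projection `E*_G`. Bounded `C²` domains `G` are replaced by compact
sets `K` (each lies in a ball).

## References

* D. Chae, J. Wolf, Ann. Inst. H. Poincaré C Anal. Non Linéaire 35 (2018) 1019–1039 =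
  arXiv:1610.01386, Definition 1.2 (p. 4), Theorem 1.4 (p. 4), Appendix B (Lemma B.5, (B.9))
  [ChaeWolf2018].
* Z. Bradshaw, T.-P. Tsai, Analysis & PDE 12 (2019) 1943–1962 = arXiv:1801.08060, Thm 1.2 and
  Comments on Thm 1.2 [BradshawTsai2019].
* J. C. Robinson, J. L. Rodrigo, W. Sadowski, *The Three-Dimensional Navier–Stokes Equations*
  (CUP 2016), §3.1 (weak vs. distributional formulations) [RobinsonRodrigoSadowski2016].
-/

noncomputable section

open _root_.MeasureTheory TopologicalSpace Set Function Filter _root_.Topology InnerProductSpace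
  Metric
open scoped RealInnerProductSpace ENNReal NNReal Laplacian

namespace Literature.Analysis.FluidPDE

namespace ChaeWolf2018

/-! ### Countable exhaustion of the open time half-line -/

/-- `(0, ∞) = ⋃ₙ (0, n + 1)` (Archimedean exhaustion). [folklore] -/
theorem Ioi_zero_eq_iUnion_Ioo_nat_succ : Ioi (0 : ℝ) = ⋃ n : ℕ, Ioo (0 : ℝ) ((n : ℝ) + 1) := by
  ext t
  simp only [mem_Ioi, mem_iUnion, mem_Ioo]
  constructor
  · intro ht
    obtain ⟨n, hn⟩ := exists_nat_gt t
    exact ⟨n, ht, by linarith⟩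
  · rintro ⟨-, ht, -⟩
    exact ht

/-- An `∀ᵐ t ∈ (0,T)` property holding for every `T > 0` holds for a.e. `t > 0`. [folklore] -/
theorem ae_restrict_Ioi_of_forall {p : ℝ → Prop}
    (h : ∀ T : ℝ, 0 < T → ∀ᵐ t ∂((volume : Measure ℝ).restrict (Ioo 0 T)), p t) :
    ∀ᵐ t ∂((volume : Measure ℝ).restrict (Ioi 0)), p t := by
  rw [Ioi_zero_eq_iUnion_Ioo_nat_succ, ae_restrict_iUnion_iff]
  exact fun n => h _ (by positivity)

/-! ### Iterated self-similarity -/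

/-- A field which is `λ`-DSS identically is `λᵏ`-DSS identically for every `k ∈ ℤ` (`λ ≠ 0`):
`nsRescale (λ ^ k) u = u` (Chae–Wolf 2018, Appendix B: (B.1) for all `k`, cf. (B.2)–(B.3)). [cite: ChaeWolf2018, Appendix B (B.1)–(B.3)] -/
theorem nsRescale_zpow_eq {X : Type*} [NormedAddCommGroup X] [NormedSpace ℝ X] {F : Type*}
    [NormedAddCommGroup F] [NormedSpace ℝ F] {c : ℝ} (hc : c ≠ 0) {u : ℝ → X → F}
    (h : IsDiscretelySelfSimilar c u) (k : ℤ) : nsRescale (c ^ k) u = u := by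
  obtain ⟨m, rfl | rfl⟩ := k.eq_nat_or_neg
  · rw [zpow_natCast]
    exact BradshawTsai2019.isDiscretelySelfSimilar_pow h m
  · rw [zpow_neg, zpow_natCast]
    exact BradshawTsai2019.isDiscretelySelfSimilar_inv (pow_ne_zero _ hc)
      (BradshawTsai2019.isDiscretelySelfSimilar_pow h m)

variable {E : Type*} [NormedAddCommGroup E] [InnerProductSpace ℝ E] [FiniteDimensional ℝ E]
  [MeasurableSpace E] [BorelSpace E]

/-- **Measurability on the open slab from measurability on finite slabs**: a field which is
a.e.-strongly measurable on `(0,T) × E` for every `T > 0` is a.e.-strongly measurable on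
`(0,∞) × E`. [folklore] -/
theorem aestronglyMeasurable_slab_Ioi_of_forall {F : Type*} [TopologicalSpace F]
    [PseudoMetrizableSpace F] {v : ℝ × E → F}
    (h : ∀ T : ℝ, 0 < T →
      AEStronglyMeasurable v ((volume : Measure (ℝ × E)).restrict (Ioo 0 T ×ˢ univ))) :
    AEStronglyMeasurable v ((volume : Measure (ℝ × E)).restrict (Ioi 0 ×ˢ univ)) := by
  rw [Ioi_zero_eq_iUnion_Ioo_nat_succ, iUnion_prod_const, aestronglyMeasurable_iUnion_iff]
  exact fun n => h _ (by positivity)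

/-! ### Weak solutions with datum are distributional solutions on the open slab -/

/-- **Weak solutions on `[0,T)` for all `T` solve the equations in `𝒟'((0,∞) × E)` against
divergence-free tests.** If `u` is a pressure-free weak solution with datum `u₀`, viscosity `ν` and
force `f` on `[0, T)` for every `T > 0` (`IsWeakNSSolutionOn T ν f u₀ u`), and `f` is integrable
on the finite cylinders, then for every test field `φ ∈ C_c^∞((0,∞) × E; E)` with divergence-free
slices `∫∫_{(0,∞)×E} (⟪u, ∂ₜφ⟫ + ⟪u, (u·∇)φ⟫ + ν⟪u, Δφ⟫ + ⟪f, φ⟫) = 0` — Chae–Wolf's Definition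
1.2 (2) (multiplied by `−1`, after `∫∫ ∇u : ∇φ = −∫∫ u·Δφ`). Proof: take `T` beyond the support of
`φ`; in the weak identity with datum the term `∫ ⟪u₀, φ(0)⟫` vanishes (`φ(0) = 0`), the iterated
integral over `(0,T) × E` is the integral over the slab (Fubini: the pairings are integrable on
`(0,T) × K`), and the integrand vanishes for `t ≥ T` (Robinson–Rodrigo–Sadowski 2016, §3.1). [cite: RobinsonRodrigoSadowski2016, §3.1] -/
theorem setIntegral_slab_Ioi_momentum_eq_zero_of_forall_isWeakNSSolutionOn {ν : ℝ}
    {f u : ℝ → E → E} {u₀ : E → E} (hweak : ∀ T : ℝ, 0 < T → IsWeakNSSolutionOn T ν f u₀ u)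
    (hf : ∀ T : ℝ, 0 < T → ∀ K : Set E, IsCompact K →
      IntegrableOn (uncurry f) (Ioo 0 T ×ˢ K) volume)
    {φ : ℝ → E → E} (hφ : IsSpaceTimeTestOn (slab E (Ioi 0) isOpen_Ioi) φ)
    (hdiv : ∀ t, VectorCalculus.IsDivFree (φ t)) :
    ∫ z in Ioi (0 : ℝ) ×ˢ (univ : Set E), (⟪u z.1 z.2, timeDeriv φ z.1 z.2⟫ +
        ⟪u z.1 z.2, convect (u z.1) (φ z.1) z.2⟫ + ν * ⟪u z.1 z.2, Δ (φ z.1) z.2⟫ +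
        ⟪f z.1 z.2, φ z.1 z.2⟫) = 0 := by
  -- Step 0: a finite slab `(0,T) × E` containing the support of `φ`
  obtain ⟨M, hM⟩ := (hφ.hasCompactSupport.isCompact.image continuous_fst).bddAbove
  set T : ℝ := max M 0 + 1 with hT_def
  have hT : 0 < T := by
    have := le_max_right M 0
    linarith
  have hsuppT : tsupport (uncurry φ) ⊆ Ioo 0 T ×ˢ (univ : Set E) := by
    intro z hz
    have h0 : z.1 ∈ Ioi (0 : ℝ) := mem_slab.1 (hφ.tsupport_subset hz)
    have h1 : z.1 ≤ M := hM ⟨z, hz, rfl⟩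
    have h2 : M < T := by
      have := le_max_left M 0
      linarith
    exact ⟨⟨h0, h1.trans_lt h2⟩, mem_univ _⟩
  have hφT : IsSpaceTimeTestOn (slab E (Ioo 0 T) isOpen_Ioo) φ :=
    ⟨hφ.contDiff, hφ.hasCompactSupport, by simpa only [coe_slab] using hsuppT⟩
  -- Step 1: the weak identity with datum on `[0, T)`; the datum term vanishes
  have key := (hweak T hT).2.2.2 φ (hφT.mono (slab_mono Ioo_subset_Iio_self)) hdiv
  have hφ0 : ∀ x, φ 0 x = 0 := fun x =>
    hφ.apply_eq_zero fun h => lt_irrefl (0 : ℝ) (mem_slab.1 h)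
  simp only [hφ0, inner_zero_right, integral_zero, add_zero] at key
  -- Step 2: integrability of the integrand on the slab `(0,T) × E`
  obtain ⟨K, hK, hKt⟩ := hφ.exists_compact_slice_subset
  have hφK : ∀ t x, x ∉ K → φ t x = 0 := fun t x hx =>
    image_eq_zero_of_notMem_tsupport fun h' => hx (hKt t h')
  have cφ : Continuous (uncurry φ) := hφ.contDiff.continuous
  have cφ' : Continuous (uncurry (timeDeriv φ)) := hφ.continuous_timeDeriv
  have cD : Continuous fun z : ℝ × E => fderiv ℝ (φ z.1) z.2 := by
    have h := ((hφ.isSmoothSpaceTimeOn univ).fderiv_slice uniqueDiffOn_univ).continuousOn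
    rw [univ_prod_univ, continuousOn_univ] at h
    exact h
  have cL : Continuous fun z : ℝ × E => Δ (φ z.1) z.2 := by
    have h := ((hφ.isSmoothSpaceTimeOn univ).laplacian uniqueDiffOn_univ).continuousOn
    rw [univ_prod_univ, continuousOn_univ] at h
    exact h
  have hD0 : ∀ t x, x ∉ K → fderiv ℝ (φ t) x = 0 := fun t x hx =>
    fderiv_of_notMem_tsupport ℝ fun h => hx (hKt t h)
  have hL0 : ∀ t x, x ∉ K → Δ (φ t) x = 0 := fun t x hx =>
    laplacian_eq_zero_of_notMem_tsupport fun h => hx (hKt t h)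
  have hφ'0 : ∀ t x, x ∉ K → timeDeriv φ t x = 0 := fun t x hx =>
    timeDeriv_eq_zero_of_forall (fun s => hφK s x hx) t
  obtain ⟨hUK1, hUK2⟩ :=
    integrableOn_cylinder_of_lintegral_sq_slab (hweak T hT).1 (hweak T hT).2.1 hK
  have iA : Integrable (fun z : ℝ × E => ⟪u z.1 z.2, timeDeriv φ z.1 z.2⟫)
      (((volume : Measure ℝ).restrict (Ioo 0 T)).prod (volume : Measure E)) :=
    integrable_slab_inner hK hUK1 cφ' hφ'0
  have iB : Integrable (fun z : ℝ × E => ⟪u z.1 z.2, convect (u z.1) (φ z.1) z.2⟫)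
      (((volume : Measure ℝ).restrict (Ioo 0 T)).prod (volume : Measure E)) :=
    integrable_slab_inner_clm_apply hK hUK1 hUK2 cD hD0
  have iC : Integrable (fun z : ℝ × E => ⟪u z.1 z.2, Δ (φ z.1) z.2⟫)
      (((volume : Measure ℝ).restrict (Ioo 0 T)).prod (volume : Measure E)) :=
    integrable_slab_inner hK hUK1 cL hL0
  have iF : Integrable (fun z : ℝ × E => ⟪f z.1 z.2, φ z.1 z.2⟫)
      (((volume : Measure ℝ).restrict (Ioo 0 T)).prod (volume : Measure E)) :=
    integrable_slab_inner hK (hf T hT K hK) cφ hφK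
  set Φ : ℝ × E → ℝ := fun z => ⟪u z.1 z.2, timeDeriv φ z.1 z.2⟫ +
    ⟪u z.1 z.2, convect (u z.1) (φ z.1) z.2⟫ + ν * ⟪u z.1 z.2, Δ (φ z.1) z.2⟫ +
    ⟪f z.1 z.2, φ z.1 z.2⟫ with hΦ
  have iΦ : Integrable Φ (((volume : Measure ℝ).restrict (Ioo 0 T)).prod (volume : Measure E)) :=
    ((iA.add iB).add (iC.const_mul ν)).add iF
  -- Step 3: Fubini on the finite slab
  have hslabT : ∫ z in Ioo 0 T ×ˢ (univ : Set E), Φ z = 0 := by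
    rw [volume_restrict_slab_eq, integral_prod _ iΦ]
    exact key
  -- Step 4: the integrand vanishes for `t ≥ T`
  have hsubT : Ioo 0 T ×ˢ (univ : Set E) ⊆ Ioi 0 ×ˢ univ := prod_mono Ioo_subset_Ioi_self Subset.rfl
  rw [setIntegral_eq_of_subset_of_forall_sdiff_eq_zero (measurableSet_Ioi.prod MeasurableSet.univ)
    hsubT]
  · exact hslabT
  · rintro ⟨t, x⟩ ⟨-, hz⟩
    have ht : t ∉ Ioo 0 T := fun h' => hz ⟨h', mem_univ x⟩
    exact momentumIntegrand_eq_zero_of_notMem_Ioo (ν := ν) hφT ht (u t) (f t) x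

end ChaeWolf2018

/-! ### Definition 1.2 (1)–(3) with (B.9), for a given field -/

section Fact

/-- Local notation for physical space `ℝ³ = EuclideanSpace ℝ (Fin 3)`. -/
local notation "ℝ³" => EuclideanSpace ℝ (Fin 3)

/-- **Chae–Wolf 2018, Definition 1.2 (1)–(3) together with Lemma B.5 (B.9), printed form, for a
given field** (*Existence of discretely self-similar solutions to the Navier–Stokes equations for
initial value in `L²_loc(ℝ³)`*, arXiv:1610.01386 = Ann. Inst. H. Poincaré C 35 (2018), Def 1.2,
Thm 1.4, Lemma B.5). Theorem 1.4 asserts, for any `λ`-DSS datum `u₀ ∈ L²_{loc,σ}(ℝ³)`, the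
existence of *a local Leray solution with projected pressure `u ∈ L²_{loc,σ}(ℝ³ × [0,∞))` in the
sense of Definition 1.2 which is discretely self-similar*; this predicate collects what that says
about the pair `(u₀, u)` for the factor `λ = c`, clause by clause (module docstring of
`ChaeWolfLocalLeray.lean`, "Rendering of the print-shaped fact", for the dictionary):
* `u ∈ L²_loc(ℝ³ × [0,∞))`: `u` is a.e.-strongly measurable on the open slab `(0,∞) × ℝ³`
  (`aestronglyMeasurable`) and `∫_{(0,T)×K} |u|² < ∞` for all `T > 0`, `K` compact
  (`lintegral_sq_lt_top`);
* `u` is `λ`-DSS with `M(u) ⊇ (0, ∞)` (Lemma B.5, (B.9): the weakly continuous representative of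
  Definition 1.2 (1) is slice-wise self-similar at *every* time): for every `t > 0` and `k ∈ ℤ`,
  `u(t, x) = λᵏ u(λ²ᵏ t, λᵏ x)` for a.e. `x` (`slice_dss`);
* (1) `u ∈ L^∞(0,T; L²(K))` (`∀ᵐ t ∈ (0,T)`, `∫_K |u(t)|² ≤ C`; `linfty_l2`) and
  `∇u ∈ L²((0,T) × K)` (a weak spatial gradient `G` on the slab with `∫_{(0,T)×K} |G|² < ∞`;
  `gradient_l2`) for all compact `K`, `T > 0`, and `u(t)` is weakly divergence free for a.e. `t > 0`
  (the index `σ`; `ae_isWeaklyDivFree`);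
* (2) `u` is a distributional solution on `Q = ℝ³ × (0,∞)`: for every `φ ∈ C_c^∞(Q; ℝ³)` with
  `div φ = 0`, `∫∫_Q (⟪u, ∂ₜφ⟫ + ⟪u, (u·∇)φ⟫ + ⟪u, Δφ⟫) = 0` — the identity of Definition 1.2 (2)
  multiplied by `−1`, with `u ⊗ u : ∇φ = ⟪u, (u·∇)φ⟫` and `∫∫ ∇u : ∇φ = −∫∫ ⟪u, Δφ⟫`
  (legitimate for `∇u ∈ L²_loc(Q)`) (`distributional`);
* (3) `u(t) → u₀` in `L²(K)` as `t → 0⁺` for every compact `K` (`tendsto_datum`).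
**Omitted**: the weak continuity `u ∈ C_w([0,T]; L²(G))` in (1) and item (4), the local energy
inequality with projected pressure (no Stokes pressure projection `E*_G` in the tree); bounded `C²`
domains `G` are replaced by compact `K` (each lies in a ball). For `λ`-DSS data the existence of
such a `u` for every datum is equivalent to the tree's rendering `chaeWolf2018_dss_existence` of
Theorem 1.4 (`chaeWolf2018_dss_existence_iff_isDSSLocalLeraySolution`). [cite: ChaeWolf2018, Def 1.2 (1)–(3) with Thm 1.4 and Lemma B.5 (B.9)] -/
structure ChaeWolf2018.IsDSSLocalLeraySolution (c : ℝ) (u₀ : ℝ³ → ℝ³) (u : ℝ → ℝ³ → ℝ³) :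
    Prop where
  /-- `u ∈ L²_loc(ℝ³ × [0,∞))`, measurability: `u` is a.e.-strongly measurable on `(0,∞) × ℝ³`. -/
  aestronglyMeasurable :
    AEStronglyMeasurable (uncurry u) (volume.restrict (Ioi (0 : ℝ) ×ˢ (univ : Set ℝ³)))
  /-- `u ∈ L²_loc(ℝ³ × [0,∞))`, integrability: `∫_{(0,T)×K} |u|² < ∞`. -/
  lintegral_sq_lt_top : ∀ T : ℝ, 0 < T → ∀ K : Set ℝ³, IsCompact K →
    ∫⁻ z in Ioo 0 T ×ˢ K, ‖u z.1 z.2‖ₑ ^ 2 < (⊤ : ℝ≥0∞)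
  /-- Discrete self-similarity of every slice, (B.9): `u(t,·) = λᵏu(λ²ᵏt, λᵏ·)` a.e., all `t > 0`,
  `k ∈ ℤ`. -/
  slice_dss : ∀ t : ℝ, 0 < t → ∀ k : ℤ, u t =ᵐ[volume] nsRescale (c ^ k) u t
  /-- Definition 1.2 (1), `u ∈ L^∞(0,T; L²(K))`. -/
  linfty_l2 : ∀ K : Set ℝ³, IsCompact K → ∀ T : ℝ, 0 < T →
    ∃ C : ℝ≥0, ∀ᵐ t ∂(volume.restrict (Ioo 0 T)), ∫⁻ x in K, ‖u t x‖ₑ ^ 2 ≤ C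
  /-- Definition 1.2 (1), `∇u ∈ L²((0,T) × K)`: a weak spatial gradient on the open slab, square
  integrable on finite cylinders. -/
  gradient_l2 : ∃ G : ℝ → ℝ³ → ℝ³ →L[ℝ] ℝ³,
    HasWeakSpatialGradientOn (slab ℝ³ (Ioi 0) isOpen_Ioi) u G ∧
    ∀ K : Set ℝ³, IsCompact K → ∀ T : ℝ, 0 < T →
      ∫⁻ z in Ioo 0 T ×ˢ K, ENNReal.ofReal (frobeniusNormSq (G z.1 z.2)) < (⊤ : ℝ≥0∞)
  /-- Definition 1.2 (1), the index `σ`: a.e. slice `t > 0` is weakly divergence free. -/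
  ae_isWeaklyDivFree : ∀ᵐ t ∂(volume.restrict (Ioi (0 : ℝ))), IsWeaklyDivFree (u t)
  /-- Definition 1.2 (2): distributional solution on `ℝ³ × (0,∞)` against divergence-free tests. -/
  distributional : ∀ φ : ℝ → ℝ³ → ℝ³, IsSpaceTimeTestOn (slab ℝ³ (Ioi 0) isOpen_Ioi) φ →
    (∀ t, VectorCalculus.IsDivFree (φ t)) →
    ∫ z in Ioi (0 : ℝ) ×ˢ (univ : Set ℝ³), (⟪u z.1 z.2, timeDeriv φ z.1 z.2⟫ +
      ⟪u z.1 z.2, convect (u z.1) (φ z.1) z.2⟫ + ⟪u z.1 z.2, Δ (φ z.1) z.2⟫) = 0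
  /-- Definition 1.2 (3): `u(t) → u₀` in `L²(K)` as `t → 0⁺`, every compact `K`. -/
  tendsto_datum : ∀ K : Set ℝ³, IsCompact K →
    Tendsto (fun t => ∫⁻ x in K, ‖u t x - u₀ x‖ₑ ^ 2) (𝓝[>] 0) (𝓝 0)

/-! ### The printed clauses give the rendered ones -/

/-- **Chae–Wolf's printed clauses imply the rendered ones, with the witness `dssRepr λ u`.** If
`u` satisfies Definition 1.2 (1)–(3) with (B.9) for the datum `u₀` (measurable) and the factor
`λ = c > 1`, then its everywhere-`λ`-DSS representative `v = dssRepr λ u` (`ChaeWolfLocalLeray.lean`)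
satisfies the five clauses of `chaeWolf2018_dss_existence`: `nsRescale λ v = v` identically; `v` is
a pressure-free weak solution with datum `u₀` on `[0, T)` for every `T > 0`; `v(t) → u₀` in
`L²_loc`; `v ∈ L^∞(0,T; L²(K))`; `∇v ∈ L²((0,T) × K)` (weak gradient). Indeed `v` agrees with `u`
slice-wise a.e. at every `t > 0` and a.e. on the open slab (so measurability, the local energy
class, the weak gradient, weak divergence-freeness, the distributional identity and the
attainment of the datum all transfer), and the distributional identity against divergence-free
tests on `(0,∞) × ℝ³` together with the `L²_loc` attainment of the datum give Leray's weak
identity with datum on `[0, T)` by the cut-off argument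
`weakIdentity_datum_of_divFree_distributional` (the two steps described in words in the module
docstring of `SelfSimilarLiouville`, "Forward DSS existence"). [cite: ChaeWolf2018, Thm 1.4 with Def 1.2 (1)–(3) and Lemma B.5 (B.9)] -/
theorem ChaeWolf2018.IsDSSLocalLeraySolution.dssRepr_spec {c : ℝ} (hc : 1 < c) {u₀ : ℝ³ → ℝ³}
    (hm₀ : AEStronglyMeasurable u₀ volume) {u : ℝ → ℝ³ → ℝ³}
    (h : ChaeWolf2018.IsDSSLocalLeraySolution c u₀ u) :
    IsDiscretelySelfSimilar c (dssRepr c u) ∧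
      (∀ T : ℝ, 0 < T → IsWeakNSSolutionOn T 1 0 u₀ (dssRepr c u)) ∧
      (∀ K : Set ℝ³, IsCompact K →
        Tendsto (fun t => ∫⁻ x in K, ‖dssRepr c u t x - u₀ x‖ₑ ^ 2) (𝓝[>] 0) (𝓝 0)) ∧
      (∀ K : Set ℝ³, IsCompact K → ∀ T : ℝ, 0 < T →
        ∃ C : ℝ≥0, ∀ᵐ t ∂(volume.restrict (Ioo 0 T)), ∫⁻ x in K, ‖dssRepr c u t x‖ₑ ^ 2 ≤ C) ∧
      (∃ G : ℝ → ℝ³ → ℝ³ →L[ℝ] ℝ³,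
        HasWeakSpatialGradientOn (slab ℝ³ (Ioi 0) isOpen_Ioi) (dssRepr c u) G ∧
        ∀ K : Set ℝ³, IsCompact K → ∀ T : ℝ, 0 < T →
          ∫⁻ z in Ioo 0 T ×ˢ K, ENNReal.ofReal (frobeniusNormSq (G z.1 z.2)) < (⊤ : ℝ≥0∞)) := by
  obtain ⟨hmeas, hsq, hB9, hLinf, ⟨G, hG, hGL2⟩, hdivu, hmom, hdatum⟩ := h
  -- the representative and its relation to `u`
  set v : ℝ → ℝ³ → ℝ³ := dssRepr c u with hv_def
  have hslice : ∀ t, 0 < t → v t =ᵐ[volume] u t := fun t ht => dssRepr_slice_ae_eq hB9 ht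
  have hjoint : uncurry v =ᵐ[volume.restrict (Ioi (0 : ℝ) ×ˢ (univ : Set ℝ³))] uncurry u :=
    dssRepr_ae_eq_slab hc hmeas hB9
  have hmeas_v : AEStronglyMeasurable (uncurry v)
      (volume.restrict (Ioi (0 : ℝ) ×ˢ (univ : Set ℝ³))) := hmeas.congr hjoint.symm
  -- slice-wise transfer of `x`-integrals
  have hlin : ∀ t, 0 < t → ∀ (K : Set ℝ³) (g : ℝ³ → ℝ³ → ℝ≥0∞),
      ∫⁻ x in K, g x (v t x) = ∫⁻ x in K, g x (u t x) := fun t ht K g =>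
    lintegral_congr_ae ((ae_restrict_of_ae (hslice t ht)).mono fun x hx => by simp only [hx])
  have hint : ∀ t, 0 < t → ∀ g : ℝ³ → ℝ³ → ℝ,
      ∫ x, g x (v t x) = ∫ x, g x (u t x) := fun t ht g =>
    integral_congr_ae ((hslice t ht).mono fun x hx => by simp only [hx])
  -- restriction of the joint statements to `(0, T)`
  have hsubT : ∀ T : ℝ, Ioo 0 T ×ˢ (univ : Set ℝ³) ⊆ Ioi 0 ×ˢ univ := fun T =>
    prod_mono Ioo_subset_Ioi_self Subset.rfl
  have hmeasT : ∀ T : ℝ, AEStronglyMeasurable (uncurry u)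
      (volume.restrict (Ioo (0 : ℝ) T ×ˢ (univ : Set ℝ³))) := fun T =>
    hmeas.mono_measure (Measure.restrict_mono (hsubT T) le_rfl)
  have hmeas_vT : ∀ T : ℝ, AEStronglyMeasurable (uncurry v)
      (volume.restrict (Ioo (0 : ℝ) T ×ˢ (univ : Set ℝ³))) := fun T =>
    hmeas_v.mono_measure (Measure.restrict_mono (hsubT T) le_rfl)
  have hsq_v : ∀ T : ℝ, 0 < T → ∀ K : Set ℝ³, IsCompact K →
      ∫⁻ z in Ioo 0 T ×ˢ K, ‖uncurry v z‖ₑ ^ 2 < ⊤ := by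
    intro T hT K hK
    have hae : uncurry v =ᵐ[volume.restrict (Ioo (0 : ℝ) T ×ˢ K)] uncurry u :=
      ae_restrict_of_ae_restrict_of_subset (prod_mono Ioo_subset_Ioi_self (subset_univ K)) hjoint
    rw [lintegral_congr_ae (hae.mono fun z hz => by rw [hz])]
    exact hsq T hT K hK
  -- weak divergence-freeness of the slices of `v`
  have hdiv_v : ∀ t, 0 < t → IsWeaklyDivFree (u t) → IsWeaklyDivFree (v t) := by
    intro t ht hu θ hθ
    rw [hint t ht fun x w => ⟪w, gradient θ x⟫]
    exact hu θ hθ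
  refine ⟨isDiscretelySelfSimilar_dssRepr hc u, fun T hT => ?_, fun K hK => ?_,
    fun K hK T hT => ?_, ⟨G, ?_, hGL2⟩⟩
  · -- weak solution with datum on `[0, T)`
    refine ⟨hmeas_vT T, hsq_v T hT, ?_, fun ψ hψ hdivψ => ?_⟩
    · filter_upwards [ae_restrict_of_ae_restrict_of_subset Ioo_subset_Ioi_self hdivu,
        ae_restrict_mem measurableSet_Ioo] with t ht htm
      exact hdiv_v t htm.1 ht
    · -- reduce to `u` slice-wise, then apply the cut-off argument to `u`
      have hred : (∫ t in Ioo 0 T, ∫ x, (⟪v t x, timeDeriv ψ t x⟫ +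
          ⟪v t x, convect (v t) (ψ t) x⟫ + 1 * ⟪v t x, Δ (ψ t) x⟫ +
          ⟪(0 : ℝ → ℝ³ → ℝ³) t x, ψ t x⟫)) =
          ∫ t in Ioo 0 T, ∫ x, (⟪u t x, timeDeriv ψ t x⟫ +
          ⟪u t x, convect (u t) (ψ t) x⟫ + 1 * ⟪u t x, Δ (ψ t) x⟫ +
          ⟪(0 : ℝ → ℝ³ → ℝ³) t x, ψ t x⟫) := by
        refine setIntegral_congr_fun measurableSet_Ioo fun t ht => ?_
        exact hint t ht.1 fun x w => ⟪w, timeDeriv ψ t x⟫ + ⟪w, convect (fun _ => w) (ψ t) x⟫ +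
          1 * ⟪w, Δ (ψ t) x⟫ + ⟪(0 : ℝ → ℝ³ → ℝ³) t x, ψ t x⟫
      rw [hred]
      have hUK : ∀ K : Set ℝ³, IsCompact K → IntegrableOn (uncurry u) (Ioo 0 T ×ˢ K) volume ∧
          IntegrableOn (fun z => ‖uncurry u z‖ ^ 2) (Ioo 0 T ×ˢ K) volume := fun K hK =>
        integrableOn_cylinder_of_lintegral_sq_slab (hmeasT T) (fun K hK => hsq T hT K hK) hK
      have hgood := ae_slice_aestronglyMeasurable_and_lintegral_ball_lt_top (hmeasT T)
        (fun K hK => hsq T hT K hK)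
      have hmomT : ∀ ψ : ℝ → ℝ³ → ℝ³, IsSpaceTimeTestOn (slab ℝ³ (Ioo 0 T) isOpen_Ioo) ψ →
          (∀ t, VectorCalculus.IsDivFree (ψ t)) →
          ∫ z in Ioo 0 T ×ˢ (univ : Set ℝ³), (⟪u z.1 z.2, timeDeriv ψ z.1 z.2⟫ +
            ⟪u z.1 z.2, convect (u z.1) (ψ z.1) z.2⟫ + 1 * ⟪u z.1 z.2, Δ (ψ z.1) z.2⟫ +
            ⟪(0 : ℝ → ℝ³ → ℝ³) z.1 z.2, ψ z.1 z.2⟫) = 0 := by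
        intro ψ hψ hdivψ
        have key := hmom ψ (hψ.mono (slab_mono Ioo_subset_Ioi_self)) hdivψ
        rw [setIntegral_eq_of_subset_of_forall_sdiff_eq_zero
          (measurableSet_Ioi.prod MeasurableSet.univ) (hsubT T)] at key
        · simpa only [one_mul, Pi.zero_apply, inner_zero_left, add_zero] using key
        · rintro ⟨t, x⟩ ⟨-, hz⟩
          have ht : t ∉ Ioo 0 T := fun h' => hz ⟨h', mem_univ x⟩
          have := momentumIntegrand_eq_zero_of_notMem_Ioo (ν := 1) hψ ht (u t) 0 x
          simpa only [one_mul, Pi.zero_apply, inner_zero_left, add_zero] using this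
      have hf : ∀ K : Set ℝ³, IsCompact K →
          IntegrableOn (uncurry (0 : ℝ → ℝ³ → ℝ³)) (Ioo 0 T ×ˢ K) volume := fun K hK =>
        integrableOn_zero
      exact weakIdentity_datum_of_divFree_distributional hT hUK hmomT hf hgood hm₀ hdatum hψ hdivψ
  · -- attainment of the datum
    refine (hdatum K hK).congr' ?_
    filter_upwards [self_mem_nhdsWithin] with t ht
    exact (hlin t ht K fun x w => ‖w - u₀ x‖ₑ ^ 2).symm
  · -- `L^∞(0,T; L²(K))`
    obtain ⟨C, hC⟩ := hLinf K hK T hT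
    refine ⟨C, ?_⟩
    filter_upwards [hC, ae_restrict_mem measurableSet_Ioo] with t ht htm
    rw [hlin t htm.1 K fun x w => ‖w‖ₑ ^ 2]
    exact ht
  · -- the weak spatial gradient is unchanged
    refine ⟨hG.locallyIntegrableOn.congr (by simpa only [coe_slab] using hjoint.symm),
      hG.locallyIntegrableOn_grad, fun φ hφ a b => ?_⟩
    have hslices : (fun t => ∫ x, fderiv ℝ (φ t) x a * ⟪v t x, b⟫) =
        fun t => ∫ x, fderiv ℝ (φ t) x a * ⟪u t x, b⟫ := by
      funext t
      rcases le_or_gt t 0 with ht | ht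
      · have hφ0 : φ t = fun _ => 0 := funext fun x =>
          hφ.apply_eq_zero (by simp [not_lt.2 ht])
        simp [hφ0]
      · exact hint t ht fun x w => fderiv ℝ (φ t) x a * ⟪w, b⟫
    rw [hslices]
    exact hG.integral_fderiv_mul_inner_eq φ hφ a b

/-- **Chae–Wolf's Theorem 1.4 read in printed form implies the tree's rendering
`chaeWolf2018_dss_existence`**: if every `λ`-DSS datum `u₀ ∈ L²_{loc,σ}(ℝ³)` admits a field with the
printed clauses `ChaeWolf2018.IsDSSLocalLeraySolution λ u₀ u`, then `chaeWolf2018_dss_existence`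
holds (witness `dssRepr λ u`, `ChaeWolf2018.IsDSSLocalLeraySolution.dssRepr_spec`). [cite: ChaeWolf2018, Thm 1.4 with Def 1.2 (1)–(3) and Lemma B.5 (B.9)] -/
theorem chaeWolf2018_dss_existence_of_isDSSLocalLeraySolution
    (h : ∀ {c : ℝ}, 1 < c → ∀ {u₀ : ℝ³ → ℝ³}, AEStronglyMeasurable u₀ volume →
      LocallyIntegrable (fun x => ‖u₀ x‖ ^ 2) volume → IsWeaklyDivFree u₀ →
        nsRescaleData c u₀ = u₀ →
      ∃ u : ℝ → ℝ³ → ℝ³, ChaeWolf2018.IsDSSLocalLeraySolution c u₀ u) :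
    chaeWolf2018_dss_existence := by
  intro c hc u₀ hm₀ hL2 hdiv hdss
  obtain ⟨u, hu⟩ := h hc hm₀ hL2 hdiv hdss
  exact ⟨dssRepr c u, hu.dssRepr_spec hc hm₀⟩

/-! ### The rendered clauses give the printed ones -/

/-- **The rendered clauses imply Chae–Wolf's printed ones, for the same field.** Let `u` be
`λ`-DSS identically (`λ ≠ 0`), a pressure-free weak solution with datum `u₀` on `[0,T)` for every
`T > 0`, with the `L²_loc` attainment of the datum, the local energy class and a weak gradient in
`L²((0,T) × K)` — the five clauses of `chaeWolf2018_dss_existence`. Then `u` satisfies Definition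
1.2 (1)–(3) with (B.9): measurability on the open slab and weak divergence-freeness of a.e. slice
by countable exhaustion of `(0,∞)`, the every-slice self-similarity (B.9) because `u` is even
`λᵏ`-DSS identically, and Definition 1.2 (2) on `ℝ³ × (0,∞)` from the weak identities with datum
(`ChaeWolf2018.setIntegral_slab_Ioi_momentum_eq_zero_of_forall_isWeakNSSolutionOn`); the remaining
clauses are verbatim. [cite: ChaeWolf2018, Thm 1.4 with Def 1.2 (1)–(3) and Lemma B.5 (B.9)] -/
theorem ChaeWolf2018.isDSSLocalLeraySolution_of_isWeakNSSolutionOn {c : ℝ} (hc : c ≠ 0)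
    {u₀ : ℝ³ → ℝ³} {u : ℝ → ℝ³ → ℝ³} (hdssu : IsDiscretelySelfSimilar c u)
    (hweak : ∀ T : ℝ, 0 < T → IsWeakNSSolutionOn T 1 0 u₀ u)
    (hdatum : ∀ K : Set ℝ³, IsCompact K →
      Tendsto (fun t => ∫⁻ x in K, ‖u t x - u₀ x‖ₑ ^ 2) (𝓝[>] 0) (𝓝 0))
    (hLinf : ∀ K : Set ℝ³, IsCompact K → ∀ T : ℝ, 0 < T →
      ∃ C : ℝ≥0, ∀ᵐ t ∂(volume.restrict (Ioo 0 T)), ∫⁻ x in K, ‖u t x‖ₑ ^ 2 ≤ C)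
    (hgrad : ∃ G : ℝ → ℝ³ → ℝ³ →L[ℝ] ℝ³,
      HasWeakSpatialGradientOn (slab ℝ³ (Ioi 0) isOpen_Ioi) u G ∧
      ∀ K : Set ℝ³, IsCompact K → ∀ T : ℝ, 0 < T →
        ∫⁻ z in Ioo 0 T ×ˢ K, ENNReal.ofReal (frobeniusNormSq (G z.1 z.2)) < (⊤ : ℝ≥0∞)) :
    ChaeWolf2018.IsDSSLocalLeraySolution c u₀ u := by
  refine ⟨?_, fun T hT K hK => (hweak T hT).2.1 K hK, fun t _ k => ?_, hLinf, hgrad, ?_,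
    fun φ hφ hdivφ => ?_, hdatum⟩
  · exact ChaeWolf2018.aestronglyMeasurable_slab_Ioi_of_forall fun T hT => (hweak T hT).1
  · have hk := ChaeWolf2018.nsRescale_zpow_eq hc hdssu k
    exact Eventually.of_forall fun x => (congrFun (congrFun hk t) x).symm
  · exact ChaeWolf2018.ae_restrict_Ioi_of_forall fun T hT => (hweak T hT).2.2.1
  · have hf : ∀ T : ℝ, 0 < T → ∀ K : Set ℝ³, IsCompact K →
        IntegrableOn (uncurry (0 : ℝ → ℝ³ → ℝ³)) (Ioo 0 T ×ˢ K) volume := fun T _ K _ =>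
      integrableOn_zero
    have key := ChaeWolf2018.setIntegral_slab_Ioi_momentum_eq_zero_of_forall_isWeakNSSolutionOn
      hweak hf hφ hdivφ
    simpa only [one_mul, Pi.zero_apply, inner_zero_left, add_zero] using key

/-- **The tree's rendering `chaeWolf2018_dss_existence` gives, for every `λ`-DSS datum, a field with
Chae–Wolf's printed clauses** (the same field: `ChaeWolf2018.isDSSLocalLeraySolution_of_isWeakNSSolutionOn`). [cite: ChaeWolf2018, Thm 1.4 with Def 1.2 (1)–(3) and Lemma B.5 (B.9)] -/
theorem ChaeWolf2018.exists_isDSSLocalLeraySolution_of_dss_existence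
    (h : chaeWolf2018_dss_existence) {c : ℝ} (hc : 1 < c) {u₀ : ℝ³ → ℝ³}
    (hm₀ : AEStronglyMeasurable u₀ volume) (hL2 : LocallyIntegrable (fun x => ‖u₀ x‖ ^ 2) volume)
    (hdiv : IsWeaklyDivFree u₀) (hdss : nsRescaleData c u₀ = u₀) :
    ∃ u : ℝ → ℝ³ → ℝ³, ChaeWolf2018.IsDSSLocalLeraySolution c u₀ u := by
  obtain ⟨u, hdssu, hweak, hdatum, hLinf, hgrad⟩ := h hc hm₀ hL2 hdiv hdss
  exact ⟨u, ChaeWolf2018.isDSSLocalLeraySolution_of_isWeakNSSolutionOn (zero_lt_one.trans hc).ne'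
    hdssu hweak hdatum hLinf hgrad⟩

/-- **The two readings of Chae–Wolf 2018, Theorem 1.4, are equivalent**: the tree's rendering
`chaeWolf2018_dss_existence` (everywhere-`λ`-DSS pressure-free weak solution with datum on every
`[0,T)`) and the printed form (for every `λ`-DSS datum a field with Definition 1.2 (1)–(3) and
(B.9), `ChaeWolf2018.IsDSSLocalLeraySolution`). [cite: ChaeWolf2018, Thm 1.4 with Def 1.2 (1)–(3) and Lemma B.5 (B.9)] -/
theorem chaeWolf2018_dss_existence_iff_isDSSLocalLeraySolution :
    chaeWolf2018_dss_existence ↔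
      ∀ {c : ℝ}, 1 < c → ∀ {u₀ : ℝ³ → ℝ³}, AEStronglyMeasurable u₀ volume →
        LocallyIntegrable (fun x => ‖u₀ x‖ ^ 2) volume → IsWeaklyDivFree u₀ →
          nsRescaleData c u₀ = u₀ →
        ∃ u : ℝ → ℝ³ → ℝ³, ChaeWolf2018.IsDSSLocalLeraySolution c u₀ u := by
  constructor
  · intro h c hc u₀ hm₀ hL2 hdiv hdss
    exact ChaeWolf2018.exists_isDSSLocalLeraySolution_of_dss_existence h hc hm₀ hL2 hdiv hdss
  · exact chaeWolf2018_dss_existence_of_isDSSLocalLeraySolution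

/-- **Bradshaw–Tsai's Theorem 1.2 gives Chae–Wolf's Theorem 1.4 in printed form** (at the level of
the renderings; Bradshaw–Tsai 2019, Comments on Thm 1.2: "a slight refinement of the main result of
[Chae–Wolf]"): `bradshawTsai2019_dss_existence` implies `chaeWolf2018_dss_existence`
(`chaeWolf2018_dss_existence_of_bradshawTsai2019`), whence the printed clauses. The discharge of
Theorem 1.4 is pursued in the tree along this line (`chaeWolf2018_dss_existence_of_prop_3_1` and its
refinements in the `ForwardDSS*.lean` files compose with
`ChaeWolf2018.exists_isDSSLocalLeraySolution_of_dss_existence` in the same way). [cite: BradshawTsai2019, Comments on Thm 1.2] -/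
theorem ChaeWolf2018.exists_isDSSLocalLeraySolution_of_bradshawTsai2019
    (h : bradshawTsai2019_dss_existence) {c : ℝ} (hc : 1 < c) {u₀ : ℝ³ → ℝ³}
    (hm₀ : AEStronglyMeasurable u₀ volume) (hL2 : LocallyIntegrable (fun x => ‖u₀ x‖ ^ 2) volume)
    (hdiv : IsWeaklyDivFree u₀) (hdss : nsRescaleData c u₀ = u₀) :
    ∃ u : ℝ → ℝ³ → ℝ³, ChaeWolf2018.IsDSSLocalLeraySolution c u₀ u :=
  ChaeWolf2018.exists_isDSSLocalLeraySolution_of_dss_existence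
    (chaeWolf2018_dss_existence_of_bradshawTsai2019 h) hc hm₀ hL2 hdiv hdss

end Fact

end Literature.Analysis.FluidPDE

end
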